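import Literature.AlgebraicGeometry.GroupSchemes.InfinitesimalKilledByFrobeniusPower   -- ★ p845102 (FK): `sub_appTop_appTop_mem_ker`, B-p12's twist API
import Literature.AlgebraicGeometry.Motives.AbelianVarietyFrobeniusKernelBlocks          -- ★ p845240 (BLK): `isMonHom_relFrobeniusOver`, `comp_relFrobeniusOver_eq_one_iff`
import Literature.AlgebraicGeometry.GroupSchemes.BTGroupConnectedDimOneCoordinates      -- ★ p845010 (S): `IsConnectedDimOne`, §1 lemmas
import Literature.RingTheory.PrincipalIdealRing.MonogenicLocalAlgebraIdeals             -- ★ A–M 8.8: ideals of a monogenic local algebra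
import Mathlib.AlgebraicGeometry.Morphisms.ClosedImmersion
import HarnessLib

/-!
# The Frobenius kernel of a connected one-dimensional BT group in its natural coordinate: `Ker F^t = V(x^{p^t})`,
# rank `p^t`, independent of the layer; closed subschemes of a monogenic infinitesimal scheme are nested by rank

Topic `Literature/AlgebraicGeometry/GroupSchemes`; namespace `Literature.AlgebraicGeometry.GroupSchemes`.  THEOREMS ONLY (no
definition, no named fact, no instance, no notation, no `sorry`).  Cell `hodgecm-mathlib` (D-0151), FLOOR 0, P6 «MOD programme» (crux
hLiu418 = stmt-HodgeConjecture-24832), organ **(FKw)** of the K∕BT desk's cut of ST-1 «Frobenius kernels of the blocks»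
(`F0/P6/F0P6d-plan/ST1-CUT.v1.F0P6dplan-g0.md` §1 (W)): for the `w`-block `𝒢` (a connected one-dimensional BT group over the residue
field) HEART-FROB needs «`V(X^q) ⊆ 𝒢ₙ` is a closed subgroup, finite of rank `q`, independent of `n`, and every closed subscheme killed by
the `q`-Frobenius lies in it» ((FKw-a,b)), and — for the `μ`-ordinary road — «a closed subscheme of `𝒢⁰ₙ` is determined by its rank» (so
`𝒢⁰ₙ[ϖ] = Ker F_q` from `rank = q` on both sides).  HC_CM is proved only modulo the printed citations until rung 0 closes; nothing here
is about HC.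

THE PRINT.  A connected `p`-divisible group of dimension one over a field `k ⊇ 𝔽_p` has layers `𝒢ₙ = Spec k[X]⧸(X^{p^{nH}})`
([Tate1967] §2.2, proof of Prop. 1; [Messing1972] II (3.3.18)) — the tree's ★ `IsConnectedDimOne` ∕ ★
`BTGroup.exists_naturalCoordinates_of_isConnectedDimOne`.  In `A = k[X]⧸(X^N)` the ideals are exactly the chain `(X̄^j)`, `0 ≤ j ≤ N`, so
an ideal — a closed subscheme of `Spec A` — is determined by its colength = rank ([AtiyahMacdonald1969] Prop. 8.8 and the Example after
it; tree ★ `MonogenicLocalAlgebraIdeals`).  The relative `p^t`-Frobenius `F^t : G → G^{(p^t)}` of a `k`-group scheme `G = Spec A` is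
`a ⊗ c ↦ a^{p^t} c` on coordinate rings, so its kernel `G ×_{G^{(p^t)}, e} Spec k` ([SGA3I] VII_A 4.1–4.3; [GortzWedhorn2020] Def. 4.45 (2))
is cut out by the `p^t`-th powers of the augmentation ideal: for `A` local with augmentation ideal `(x)` this is `V(x^{p^t})`, of rank
`min(p^t, N)` ([Demazure1972] II §7 (Frobenius of infinitesimal groups), III §6; [Tate1997FiniteFlatGroupSchemes] §3.7).

THE ROUTE (tree vocabulary: B-p12's ★ `relFrobeniusOver p t G : G ⟶ frobeniusTwistOver p t G`, the twist a group object by Mathlib's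
transported structure `Functor.grpObjObj` (`open scoped Obj`) and `F^t` a homomorphism (★ `Motives.isMonHom_relFrobeniusOver`, p845240), ★
`GroupSchemeKernel.ker ∕ kerι ∕ kerLift`; Mathlib's ideal sheaves `Scheme.Hom.ker`, `IsClosedImmersion.lift ∕ isIso_of_ker_eq`,
`Scheme.ker_of_isAffine`).
§0 algebra: in a finite-dimensional local `k`-algebra with principal maximal ideal, `dim_k A⧸I ≤ dim_k A⧸J ⇒ J ≤ I` (sibling of ★
`eq_of_finrank_quotient_eq`).  §1 MONOGENIC INFINITESIMAL `k`-SCHEMES (`G → Spec k` finite, `Γ(G)` local with principal maximal ideal):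
for closed immersions `cᵢ : Zᵢ → G` over `k` — arbitrary closed SUBSCHEMES, no group structure — `dim_k Γ(Z₁) ≤ dim_k Γ(Z₂)` gives a
factorisation `Z₁ → Z₂` over `G` («closed subschemes are NESTED BY RANK»), and equal ranks make any `G`-morphism `Z₁ → Z₂` an isomorphism
(«ONE closed subscheme of each rank»).  The SUBGROUP case with ranks `p^j` and the isomorphism of two closed subgroups of equal rank is ★
`ConnectedLayerClosedSubgroups` (B-p12, p845110: `exists_ker_eq_span_pow_of_closedSubgroup`, `exists_iso_of_finrank_alg_eq`, via Hopf ideals)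
— not restated here.  §2 the criterion `c ≫ F^t = 1 ↔ F^{abs,t}_T ≫ c = (T → Spec k) ≫ Spec Frob^t ≫ e` (unit-section form);
**`Ker F^t = V(x^{p^t})`** when the augmentation ideal is `(x)` (`⊇`: `ι ≫ F^t = 1` read through `pr_G`; `⊆`: the ideal-sheaf subscheme of
`(x^{p^t})` is killed by `F^t` because `a = π a + b x ⇒ a^{p^t} = (π a)^{p^t} + b^{p^t} x^{p^t}`, hence factors through the kernel); rank
`dim_k Γ(Ker F^t) = min(p^t, N)` for `Γ(G) ≃ₐ k[X]⧸(X^N)`; (FKw-a) in both directions (`Z ⊆ V(x^{p^t}) ⇒ F^t|_Z = 1`; `F^t|_Z = 1 ⇒ rank Z ≤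
min(p^t, N)`); the map `Ker F^t_G → Ker F^t_{G'}` over a homomorphism.  §3 the layers `B.G n` of a BT group with `IsConnectedDimOne B`: rank
`p^t` for `t ≤ nH` (this IS ★ p845110's «unique closed subgroup of order `p^t`», now identified with `Ker F^t`), ideal `𝔪^{p^t}`, one point,
and the map `Ker F^t|_{𝒢ₙ} → Ker F^t|_{𝒢ₙ₊₁}` induced by `incl n` is an ISOMORPHISM («independent of `n`»).

## References
* [Tate1967] J. T. Tate, *p-divisible groups*, Proc. Conf. Local Fields (Driebergen 1966), Springer 1967 — §2.2, proof of Prop. 1.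
* [Messing1972] W. Messing, *The Crystals Associated to Barsotti–Tate Groups*, LNM 264 (1972) — Ch. II (3.3.18).
* [AtiyahMacdonald1969] M. F. Atiyah, I. G. Macdonald, *Introduction to Commutative Algebra* (1969) — Ch. 8, Prop. 8.8 and Example.
* [SGA3I] M. Demazure, A. Grothendieck (eds.), *SGA 3, Tome I*, Exp. VII_A (P. Gabriel) §4, 4.1–4.3 (`F_{X/S}`, `Ker F_{G/S}`).
* [Demazure1972] M. Demazure, *Lectures on p-divisible groups*, LNM 302 (1972) — Ch. II §7, Ch. III §6.
* [GortzWedhorn2020] U. Görtz, T. Wedhorn, *Algebraic Geometry I* (2nd ed., 2020) — Def. 4.45 (2) (p. 117), Rem. 4.24, §(4.7).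
* [Tate1997FiniteFlatGroupSchemes] J. Tate, *Finite flat group schemes*, in: Modular Forms and Fermat's Last Theorem (1997) — §3.7.
* [Hartshorne1977] R. Hartshorne, *Algebraic Geometry*, GTM 52 (1977) — IV §2, Remark 2.4.1 (absolute and relative Frobenius).
-/

set_option autoImplicit false

noncomputable section

-- Mathlib's `Over`/`Scheme` and the transported group structures are stated across semireducible wrappers (as in ★ `GroupSchemes/*`).
set_option backward.isDefEq.respectTransparency false

open CategoryTheory CategoryTheory.Limits AlgebraicGeometry MonoidalCategory CartesianMonoidalCategory Polynomial IsLocalRing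

open scoped MonObj Obj

universe u

namespace Literature.AlgebraicGeometry.GroupSchemes

open Literature.AlgebraicGeometry.Motives GroupSchemeKernel

/-! ## §0 Algebra: in a monogenic local algebra an ideal of larger colength is smaller -/

section Algebra

variable {k : Type*} [Field k] {A : Type*} [CommRing A] [Algebra k A] [Module.Finite k A] [IsLocalRing A]

/-- **A–M 8.8, colength-monotone form**: in a finite-dimensional local `k`-algebra `A` whose maximal ideal is principal (so the ideals
are the chain `A ⊋ 𝔪 ⊋ 𝔪² ⊋ ⋯`), `dim_k A⧸I ≤ dim_k A⧸J` implies `J ≤ I`.  (The ideals are comparable, ★ `le_total_of_maximalIdeal_isPrincipal`;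
if `I ≤ J` then `dim_k A⧸J ≤ dim_k A⧸I`, so the colengths agree and `I = J` by ★ `eq_of_finrank_quotient_eq`.)
[cite: AtiyahMacdonald1969, Ch. 8, Prop. 8.8 and Example] -/
theorem ideal_le_of_finrank_quotient_le (h : (maximalIdeal A).IsPrincipal) {I J : Ideal A}
    (hIJ : Module.finrank k (A ⧸ I) ≤ Module.finrank k (A ⧸ J)) : J ≤ I := by
  haveI : IsArtinianRing A := IsArtinianRing.of_finite k A
  rcases Literature.RingTheory.PrincipalIdealRing.le_total_of_maximalIdeal_isPrincipal h I J with hle | hle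
  · have hI := Submodule.finrank_quotient_add_finrank (I.restrictScalars k)
    have hJ := Submodule.finrank_quotient_add_finrank (J.restrictScalars k)
    have hqI : Module.finrank k (A ⧸ I.restrictScalars k) = Module.finrank k (A ⧸ I) := rfl
    have hqJ : Module.finrank k (A ⧸ J.restrictScalars k) = Module.finrank k (A ⧸ J) := rfl
    have hmono : Module.finrank k (I.restrictScalars k) ≤ Module.finrank k (J.restrictScalars k) :=
      Submodule.finrank_mono (show I.restrictScalars k ≤ J.restrictScalars k from fun x hx => hle hx)
    have heq : Module.finrank k (A ⧸ I) = Module.finrank k (A ⧸ J) := by omega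
    exact (Literature.RingTheory.PrincipalIdealRing.eq_of_finrank_quotient_eq h heq).symm.le
  · exact hle

end Algebra

/-! ## §1 Monogenic infinitesimal `k`-schemes: closed subschemes are nested by rank, one of each rank -/

section Monogenic

variable {k : Type u} [Field k]

/-- `Γ` of a `k`-morphism `c : Z → G` is a `k`-ALGEBRA map (the `Over` triangle `c ≫ (G → Spec k) = (Z → Spec k)`).
[cite: GortzWedhorn2020, Section (3.2) and (4.7)] -/
theorem appTop_left_algebraMap {Z G : SchemeOver k} (c : Z ⟶ G) (r : k) :
    c.left.appTop.hom (algebraMap k (AffineGroupScheme.Alg G) r) = algebraMap k (AffineGroupScheme.Alg Z) r := by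
  have h : algebraMapΓ G.hom ≫ c.left.appTop = algebraMapΓ Z.hom := by
    rw [Category.assoc, ← Scheme.Hom.comp_appTop, Over.w c]
  rw [AffineGroupScheme.Alg.algebraMap_eq, AffineGroupScheme.Alg.algebraMap_eq, ← h]
  rfl

/-- **The affine algebra of a closed subscheme is the quotient by its ideal**: for a closed immersion `c : Z → G` over `k` into an
affine `G`, `Γ(c) : Γ(G) → Γ(Z)` is a surjective `k`-algebra map (Mathlib `IsClosedImmersion.isAffine_surjective_of_isAffine`), so
`dim_k Γ(Z) = dim_k Γ(G)⧸ker Γ(c)`. [cite: GortzWedhorn2020, Definition 4.45 (1)–(2) (p. 117), Section (3.5)] -/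
theorem finrank_alg_eq_finrank_quotient_ker {Z G : SchemeOver k} (c : Z ⟶ G) [IsAffine G.left] [IsClosedImmersion c.left] :
    Module.finrank k (AffineGroupScheme.Alg Z) =
      Module.finrank k (AffineGroupScheme.Alg G ⧸ RingHom.ker c.left.appTop.hom) := by
  let φ : AffineGroupScheme.Alg G →ₐ[k] AffineGroupScheme.Alg Z :=
    { toRingHom := c.left.appTop.hom, commutes' := appTop_left_algebraMap c }
  have hφ : Function.Surjective φ := (IsClosedImmersion.isAffine_surjective_of_isAffine c.left).2
  exact ((Ideal.quotientKerAlgEquivOfSurjective hφ).toLinearEquiv.finrank_eq).symm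

/-- **Closed subschemes of an affine scheme are NESTED BY THEIR IDEALS**: if `ker Γ(c₂) ≤ ker Γ(c₁)` for `k`-morphisms `cᵢ : Zᵢ → G` with
`c₂` a closed immersion and `G` affine, then `c₁` factors through `c₂` over `G` (Mathlib's universal property of closed immersions
`IsClosedImmersion.lift`, the ideal sheaves of an affine scheme being its ideals, `Scheme.ker_of_isAffine`).
[cite: GortzWedhorn2020, Section (3.5) and Definition 4.45 (1) (p. 117)] -/
theorem exists_fac_of_ker_appTop_le {Z₁ Z₂ G : SchemeOver k} [IsAffine G.left] (c₁ : Z₁ ⟶ G) (c₂ : Z₂ ⟶ G)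
    [IsClosedImmersion c₂.left] (h : RingHom.ker c₂.left.appTop.hom ≤ RingHom.ker c₁.left.appTop.hom) :
    ∃ f : Z₁ ⟶ Z₂, f ≫ c₂ = c₁ := by
  have hker : c₂.left.ker ≤ c₁.left.ker := by
    rw [Scheme.ker_of_isAffine, Scheme.ker_of_isAffine]
    change (Scheme.IdealSheafData.equivOfIsAffine (X := G.left)).symm _ ≤
      (Scheme.IdealSheafData.equivOfIsAffine (X := G.left)).symm _
    exact (map_le_map_iff _).mpr h
  refine ⟨Over.homMk (IsClosedImmersion.lift c₂.left c₁.left hker) ?_, ?_⟩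
  · rw [← Over.w c₂, IsClosedImmersion.lift_fac_assoc, Over.w c₁]
  · ext : 1
    exact IsClosedImmersion.lift_fac _ _ _

/-- **Closed subschemes with the same ideal are isomorphic over `G`**: a `G`-morphism `f : Z₁ → Z₂` between closed subschemes of an
affine `G` with `ker Γ(c₁) = ker Γ(c₂)` is an isomorphism (Mathlib `IsClosedImmersion.isIso_of_ker_eq`).
[cite: GortzWedhorn2020, Section (3.5) and Definition 4.45 (1) (p. 117)] -/
theorem isIso_of_ker_appTop_eq {Z₁ Z₂ G : SchemeOver k} [IsAffine G.left] (c₁ : Z₁ ⟶ G) (c₂ : Z₂ ⟶ G)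
    [IsClosedImmersion c₁.left] [IsClosedImmersion c₂.left] (f : Z₁ ⟶ Z₂) (hf : f ≫ c₂ = c₁)
    (h : RingHom.ker c₁.left.appTop.hom = RingHom.ker c₂.left.appTop.hom) : IsIso f := by
  have hker : c₁.left.ker = c₂.left.ker := by
    rw [Scheme.ker_of_isAffine, Scheme.ker_of_isAffine, h]
  haveI : IsIso ((Over.forget (Spec (CommRingCat.of k))).map f) :=
    IsClosedImmersion.isIso_of_ker_eq c₁.left c₂.left f.left (by rw [← Over.comp_left, hf]) hker
  exact isIso_of_reflects_iso f (Over.forget _)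

variable {G : SchemeOver k} [IsFinite G.hom] [IsLocalRing (AffineGroupScheme.Alg G)]

/-- **CLOSED SUBSCHEMES OF A MONOGENIC INFINITESIMAL SCHEME ARE NESTED BY RANK.**  Let `G → Spec k` be finite with `Γ(G)` local and its
maximal ideal principal (e.g. `Γ(G) ≃ k[X]⧸(X^N)`: the layers of a connected one-dimensional BT group).  If `c₁ : Z₁ → G`, `c₂ : Z₂ → G`
are closed subschemes with `dim_k Γ(Z₁) ≤ dim_k Γ(Z₂)`, then `Z₁ ⊆ Z₂`: `c₁` factors through `c₂`.  (The ideals of `Γ(G)` form a chain and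
are determined by colength — A–M 8.8.) [cite: AtiyahMacdonald1969, Ch. 8, Prop. 8.8 and Example] [cite: Tate1967, §2.2] -/
theorem exists_fac_of_finrank_alg_le (hG : (maximalIdeal (AffineGroupScheme.Alg G)).IsPrincipal) {Z₁ Z₂ : SchemeOver k}
    (c₁ : Z₁ ⟶ G) (c₂ : Z₂ ⟶ G) [IsClosedImmersion c₁.left] [IsClosedImmersion c₂.left]
    (h : Module.finrank k (AffineGroupScheme.Alg Z₁) ≤ Module.finrank k (AffineGroupScheme.Alg Z₂)) :
    ∃ f : Z₁ ⟶ Z₂, f ≫ c₂ = c₁ := by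
  haveI : IsAffine G.left := isAffine_of_isAffineHom G.hom
  haveI : Module.Finite k (AffineGroupScheme.Alg G) := AffineGroupScheme.Alg.moduleFinite G
  rw [finrank_alg_eq_finrank_quotient_ker c₁, finrank_alg_eq_finrank_quotient_ker c₂] at h
  exact exists_fac_of_ker_appTop_le c₁ c₂ (ideal_le_of_finrank_quotient_le hG h)

/-- **ONE CLOSED SUBSCHEME OF EACH RANK**: under the same hypotheses, a `G`-morphism `f : Z₁ → Z₂` between closed subschemes of EQUAL rank
`dim_k Γ(Z₁) = dim_k Γ(Z₂)` is an isomorphism (★ `eq_of_finrank_quotient_eq`: one ideal of each colength).  This is how the `μ`-ordinary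
road identifies `𝒢⁰ₙ[ϖ]` with `Ker F_q` from «rank `q`» on both sides; for two closed SUBGROUPS of equal rank the isomorphism itself is ★
`ConnectedLayerClosedSubgroups.exists_iso_of_finrank_alg_eq` (p845110). [cite: AtiyahMacdonald1969, Ch. 8, Prop. 8.8 and Example]
[cite: Tate1967, §2.2] -/
theorem isIso_of_finrank_alg_eq (hG : (maximalIdeal (AffineGroupScheme.Alg G)).IsPrincipal) {Z₁ Z₂ : SchemeOver k}
    (c₁ : Z₁ ⟶ G) (c₂ : Z₂ ⟶ G) [IsClosedImmersion c₁.left] [IsClosedImmersion c₂.left] (f : Z₁ ⟶ Z₂) (hf : f ≫ c₂ = c₁)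
    (h : Module.finrank k (AffineGroupScheme.Alg Z₁) = Module.finrank k (AffineGroupScheme.Alg Z₂)) : IsIso f := by
  haveI : IsAffine G.left := isAffine_of_isAffineHom G.hom
  haveI : Module.Finite k (AffineGroupScheme.Alg G) := AffineGroupScheme.Alg.moduleFinite G
  rw [finrank_alg_eq_finrank_quotient_ker c₁, finrank_alg_eq_finrank_quotient_ker c₂] at h
  exact isIso_of_ker_appTop_eq c₁ c₂ f hf (Literature.RingTheory.PrincipalIdealRing.eq_of_finrank_quotient_eq hG h)

end Monogenic

/-! ## §2 The relative `p^t`-Frobenius of a `k`-group scheme and its kernel -/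

section Frobenius

-- Elaborating `c ≫ F^t = 1` needs the `One (T ⟶ G^{(p^t)})` instance (Mathlib's scoped `Hom.monoid` through the transported group
-- structure `Functor.grpObjObj` of the twist); with this file's imports the instance search succeeds only above ≈ 1.2·10⁵ heartbeats
-- (measured; ★ p845240 states the same shapes at the default budget with lighter imports).  No `maxHeartbeats` (proof) budget is raised.
set_option synthInstance.maxHeartbeats 200000

variable {k : Type u} [Field k] (p : ℕ) [ExpChar k p] (t : ℕ) (G : SchemeOver k) [GrpObj G]

/-! ### §2.1 When is `c ≫ F^t = 1`? -/

/-- `F^{abs,t}_T ≫ 1 = (T → Spec k) ≫ Spec Frob^t ≫ e_G` for the trivial morphism `1 = (T → Spec k) ≫ e_G : T → G` (the absolute Frobenius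
covers `Spec Frob^t`, ★ `absFrobeniusOver_comp_hom`). [cite: SGA3I, VII_A 4.1] [cite: Hartshorne1977, IV §2 Rem. 2.4.1] -/
theorem absFrobeniusOver_comp_one_left (T : SchemeOver k) :
    absFrobeniusOver p t T ≫ (1 : T ⟶ G).left = T.hom ≫ frobSpec k p t ≫ (η[G] : 𝟙_ (SchemeOver k) ⟶ G).left := by
  have hu : (toUnit T).left = T.hom := (Category.comp_id _).symm.trans (Over.w (toUnit T))
  rw [Hom.one_def, Over.comp_left, hu, absFrobeniusOver_comp_hom_assoc]

variable {G} in
/-- **CRITERION `F^t(c) = 1`, unit-section form**: for a `T`-valued point `c : T → G` over `k`, `c ≫ F^t_{G∕k} = 1` iff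
`F^{abs,t}_T ≫ c = (T → Spec k) ≫ Spec Frob^t ≫ e_G` — ★ `Motives.comp_relFrobeniusOver_eq_one_iff` (F0P6-p16, p845240: both sides of
`c ≫ F^t = 1` are determined by their `pr_G`-projections) with its right-hand side `F^{abs,t}_T ≫ 1` rewritten by `absFrobeniusOver_comp_one_left`;
the shape of ★ `AbelianVariety.comp_relFrobenius_eq_one_iff'`. [cite: SGA3I, VII_A 4.1] -/
theorem comp_relFrobeniusOver_eq_one_iff_unit {T : SchemeOver k} (c : T ⟶ G) :
    c ≫ relFrobeniusOver p t G = 1 ↔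
      absFrobeniusOver p t T ≫ c.left = T.hom ≫ frobSpec k p t ≫ (η[G] : 𝟙_ (SchemeOver k) ⟶ G).left := by
  rw [comp_relFrobeniusOver_eq_one_iff, absFrobeniusOver_comp_one_left]

/-! ### §2.2 The augmentation ideal -/

/-- **The augmentation ideal of a `k`-group scheme with local affine algebra is the maximal ideal**: `ker Γ(e) = 𝔪`, because `Γ(e) : Γ(G) →
Γ(Spec k) ≅ k` is surjective (a section of the structure map) onto a field. [cite: Tate1997FiniteFlatGroupSchemes, §3.7]
[cite: GortzWedhorn2020, Definition 4.45 (2) (p. 117)] -/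
theorem ker_appTop_unit_eq_maximalIdeal (G : SchemeOver k) [IsLocalRing (AffineGroupScheme.Alg G)] (e : 𝟙_ (SchemeOver k) ⟶ G) :
    RingHom.ker e.left.appTop.hom = maximalIdeal (AffineGroupScheme.Alg G) := by
  have hsec : e.left ≫ G.hom = 𝟙 _ := Over.w e
  have hsurj : Function.Surjective e.left.appTop.hom := fun y => ⟨G.hom.appTop.hom y, by
    change (G.hom.appTop ≫ e.left.appTop).hom y = y
    rw [← Scheme.Hom.comp_appTop, hsec, Scheme.Hom.id_appTop]; rfl⟩
  have hfield : IsField (AffineGroupScheme.Alg G ⧸ RingHom.ker e.left.appTop.hom) :=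
    MulEquiv.isField (Field.toIsField k)
      ((RingHom.quotientKerEquivOfSurjective hsurj).trans (Scheme.ΓSpecIso (.of k)).commRingCatIsoToRingEquiv).toMulEquiv
  exact IsLocalRing.eq_maximalIdeal (R := AffineGroupScheme.Alg G)
    (Ideal.Quotient.maximal_of_isField (R := AffineGroupScheme.Alg G) _ hfield)

/-! ### §2.3 `Ker F^t = V(x^{p^t})` -/

variable {G}

/-- `⊇`: **`x^{p^t}` vanishes on `Ker F^t`** for every `x` in the augmentation ideal: `ι ≫ F^t = 1` reads `F^{abs,t} ≫ ι = (⋯) ≫ e_G` on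
`pr_G`-projections, and on global sections `Γ(ι)(x^{p^t}) = Γ(ι)(x)^{p^t} = Γ(F^{abs,t} ≫ ι)(x) = Γ(Ker → Spec k)(Frob^t(Γ(e) x)) = 0`.
[cite: SGA3I, VII_A 4.1–4.3] [cite: Demazure1972, Ch. II §7] -/
theorem pow_mem_ker_appTop_kerι_relFrobeniusOver {x : Γ(G.left, ⊤)}
    (hx : x ∈ RingHom.ker (η[G] : 𝟙_ (SchemeOver k) ⟶ G).left.appTop.hom) :
    x ^ p ^ t ∈ RingHom.ker (kerι (relFrobeniusOver p t G)).left.appTop.hom := by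
  have h1 := (comp_relFrobeniusOver_eq_one_iff_unit p t (kerι (relFrobeniusOver p t G))).mp (kerι_comp _)
  have h2 : (absFrobeniusOver p t (ker (relFrobeniusOver p t G)) ≫ (kerι (relFrobeniusOver p t G)).left).appTop.hom x =
      ((ker (relFrobeniusOver p t G)).hom ≫ frobSpec k p t ≫ (η[G] : 𝟙_ (SchemeOver k) ⟶ G).left).appTop.hom x := by
    rw [h1]
  rw [Scheme.Hom.comp_appTop, Scheme.Hom.comp_appTop, Scheme.Hom.comp_appTop] at h2
  change (absFrobeniusOver p t (ker (relFrobeniusOver p t G))).appTop.hom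
      ((kerι (relFrobeniusOver p t G)).left.appTop.hom x) =
    (ker (relFrobeniusOver p t G)).hom.appTop.hom ((frobSpec k p t).appTop.hom
      ((η[G] : 𝟙_ (SchemeOver k) ⟶ G).left.appTop.hom x)) at h2
  rw [RingHom.mem_ker] at hx ⊢
  rw [hx, map_zero, map_zero] at h2
  rw [map_pow]
  exact h2

/-- `⊆`, the key computation: **if the augmentation ideal is `(x)`, then `a^{p^t} ≡ (π a)^{p^t} (mod x^{p^t})`** for every global section
`a`, where `π a := Γ(G → Spec k)(Γ(e) a)` is the «constant part» of `a`: `a − π a ∈ ker Γ(e) = (x)`, so `a = π a + b x` and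
`a^{p^t} = (π a)^{p^t} + b^{p^t} x^{p^t}` (★ `add_pow_expChar_pow_sections`). [cite: Demazure1972, Ch. II §7] [cite: Tate1997FiniteFlatGroupSchemes, §3.7] -/
theorem pow_sub_pow_mem_span_pow {x : Γ(G.left, ⊤)}
    (hx : RingHom.ker (η[G] : 𝟙_ (SchemeOver k) ⟶ G).left.appTop.hom = Ideal.span {x}) (a : Γ(G.left, ⊤)) :
    a ^ p ^ t - (G.hom.appTop ((η[G] : 𝟙_ (SchemeOver k) ⟶ G).left.appTop a)) ^ p ^ t ∈ Ideal.span {x ^ p ^ t} := by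
  have hmem : a - G.hom.appTop ((η[G] : 𝟙_ (SchemeOver k) ⟶ G).left.appTop a) ∈ Ideal.span {x} := by
    rw [← hx]; exact sub_appTop_appTop_mem_ker G η[G] a
  obtain ⟨b, hb⟩ := Ideal.mem_span_singleton'.mp hmem
  have ha : a = G.hom.appTop ((η[G] : 𝟙_ (SchemeOver k) ⟶ G).left.appTop a) + b * x := by rw [hb, add_sub_cancel]
  have hadd := add_pow_expChar_pow_sections p t G ⊤ (G.hom.appTop ((η[G] : 𝟙_ (SchemeOver k) ⟶ G).left.appTop a)) (b * x)
  rw [← ha] at hadd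
  rw [hadd, add_sub_cancel_left, mul_pow]
  exact Ideal.mul_mem_left _ _ (Ideal.subset_span rfl)

/-- **(FKw-a), converse direction: `Z ⊆ V(x^{p^t}) ⇒ F^t` is trivial on `Z`.**  If the augmentation ideal is `(x)` and `x^{p^t}` vanishes
along a `k`-morphism `c : Z → G` (`x^{p^t} ∈ ker Γ(c)`), then `c ≫ F^t_{G∕k} = 1` — by the criterion `comp_relFrobeniusOver_eq_one_iff_unit`,
checked on global sections of the affine `G`: `Γ(c)(a^{p^t}) = Γ(c)((π a)^{p^t})` by `pow_sub_pow_mem_span_pow`.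
[cite: SGA3I, VII_A 4.1–4.3] [cite: Demazure1972, Ch. II §7] -/
theorem comp_relFrobeniusOver_eq_one_of_pow_mem_ker [IsAffine G.left] {x : Γ(G.left, ⊤)}
    (hx : RingHom.ker (η[G] : 𝟙_ (SchemeOver k) ⟶ G).left.appTop.hom = Ideal.span {x}) {Z : SchemeOver k} (c : Z ⟶ G)
    (hc : x ^ p ^ t ∈ RingHom.ker c.left.appTop.hom) : c ≫ relFrobeniusOver p t G = 1 := by
  rw [comp_relFrobeniusOver_eq_one_iff_unit, ← Over.w c, Category.assoc]
  refine ext_of_isAffine ?_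
  ext a
  rw [Scheme.Hom.comp_appTop, Scheme.Hom.comp_appTop, Scheme.Hom.comp_appTop, Scheme.Hom.comp_appTop]
  change (absFrobeniusOver p t Z).appTop (c.left.appTop a) =
    c.left.appTop (G.hom.appTop ((frobSpec k p t).appTop ((η[G] : 𝟙_ (SchemeOver k) ⟶ G).left.appTop a)))
  have hfrob : (frobSpec k p t).appTop ((η[G] : 𝟙_ (SchemeOver k) ⟶ G).left.appTop a) =
      ((η[G] : 𝟙_ (SchemeOver k) ⟶ G).left.appTop a) ^ p ^ t := by
    rw [← absFrobeniusOver_tensorUnit p t]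
    exact powEndo_appTop_apply _ _ _ _ _
  rw [powEndo_appTop_apply, hfrob, map_pow, ← map_pow, ← sub_eq_zero, ← map_sub]
  have hle : Ideal.span {x ^ p ^ t} ≤ RingHom.ker c.left.appTop.hom := by
    rw [Ideal.span_le, Set.singleton_subset_iff]; exact hc
  exact hle (pow_sub_pow_mem_span_pow p t hx a)

/-- **`Ker F^t = V(x^{p^t})`.**  For a `k`-group scheme `G` with affine underlying scheme whose augmentation ideal `ker Γ(e)` is principal,
generated by `x`, the ideal of the closed subgroup `Ker F^t_{G∕k} ↪ G` is `(x^{p^t})`: `⊇` by `pow_mem_ker_appTop_kerι_relFrobeniusOver`;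
`⊆` because Mathlib's ideal-sheaf subscheme `V(x^{p^t}) ↪ G` is killed by `F^t` (`comp_relFrobeniusOver_eq_one_of_pow_mem_ker`) hence
factors through the kernel (★ `kerLift`), so every function vanishing on `Ker F^t` vanishes on `V(x^{p^t})`.
[cite: SGA3I, VII_A 4.1–4.3] [cite: Demazure1972, Ch. II §7] [cite: GortzWedhorn2020, Definition 4.45 (2) (p. 117)] -/
theorem ker_appTop_kerι_relFrobeniusOver_eq_span [IsAffine G.left] {x : Γ(G.left, ⊤)}
    (hx : RingHom.ker (η[G] : 𝟙_ (SchemeOver k) ⟶ G).left.appTop.hom = Ideal.span {x}) :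
    RingHom.ker (kerι (relFrobeniusOver p t G)).left.appTop.hom = Ideal.span {x ^ p ^ t} := by
  refine le_antisymm ?_ ?_
  · -- `⊆`: factor `V(x^{p^t})` through the kernel
    set J : Ideal Γ(G.left, ⊤) := Ideal.span {x ^ p ^ t} with hJ
    set j := (Scheme.IdealSheafData.ofIdealTop J).subschemeι with hj
    have hkerj : RingHom.ker j.appTop.hom = J := by
      have h : (Scheme.IdealSheafData.equivOfIsAffine (X := G.left)).symm J =
          (Scheme.IdealSheafData.equivOfIsAffine (X := G.left)).symm (RingHom.ker j.appTop.hom) := by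
        simp only [Scheme.IdealSheafData.equivOfIsAffine_symm_apply]
        rw [← Scheme.ker_of_isAffine j, hj, Scheme.IdealSheafData.ker_subschemeι]
      exact ((Scheme.IdealSheafData.equivOfIsAffine (X := G.left)).symm.injective h).symm
    let Z : SchemeOver k := Over.mk (j ≫ G.hom)
    let c : Z ⟶ G := Over.homMk j rfl
    have hcx : x ^ p ^ t ∈ RingHom.ker c.left.appTop.hom := by
      change x ^ p ^ t ∈ RingHom.ker j.appTop.hom
      rw [hkerj]
      exact Ideal.mem_span_singleton_self _
    have hc := comp_relFrobeniusOver_eq_one_of_pow_mem_ker p t hx c hcx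
    have hfac := kerLift_ι c hc
    intro a ha
    have ha' : j.appTop.hom a = 0 := by
      have h : (kerLift c hc ≫ kerι (relFrobeniusOver p t G)).left.appTop.hom a = c.left.appTop.hom a := by rw [hfac]
      rw [Over.comp_left, Scheme.Hom.comp_appTop] at h
      change (kerLift c hc).left.appTop.hom ((kerι (relFrobeniusOver p t G)).left.appTop.hom a) = j.appTop.hom a at h
      rw [← h, RingHom.mem_ker.mp ha, map_zero]
    have : a ∈ RingHom.ker j.appTop.hom := ha'
    rwa [hkerj] at this
  · rw [Ideal.span_le, Set.singleton_subset_iff]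
    exact pow_mem_ker_appTop_kerι_relFrobeniusOver p t (hx ▸ Ideal.mem_span_singleton_self x)

/-! ### §2.4 Monogenic case `Γ(G) ≃ k[X]⧸(X^N)`: rank `min(p^t, N)`, one point, (FKw-a) in rank form -/

variable {N : ℕ}

/-- For `Γ(G) ≃ₐ[k] k[X]⧸(X^N)` (`N ≠ 0`) the augmentation ideal is generated by the coordinate `x := ψ⁻¹ X̄` (it is the maximal ideal,
★ `maximalIdeal_eq_span_of_algEquiv_quotient_X_pow`, and the augmentation ideal is maximal). [cite: Tate1967, §2.2]
[cite: AtiyahMacdonald1969, Ch. 8, Prop. 8.8 and Example] -/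
theorem ker_appTop_unit_eq_span_of_algEquiv (ψ : AffineGroupScheme.Alg G ≃ₐ[k] (k[X] ⧸ Ideal.span {(X : k[X]) ^ N})) (hN : N ≠ 0) :
    RingHom.ker (η[G] : 𝟙_ (SchemeOver k) ⟶ G).left.appTop.hom =
      Ideal.span {(ψ.symm (Ideal.Quotient.mk _ X) : Γ(G.left, ⊤))} := by
  haveI := isLocalRing_of_algEquiv_quotient_X_pow ψ hN
  exact (ker_appTop_unit_eq_maximalIdeal G η[G]).trans (maximalIdeal_eq_span_of_algEquiv_quotient_X_pow ψ)

omit [ExpChar k p] in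
/-- `dim_k (k[X]⧸(X^N)) ⧸ (X̄^M) = min M N` (it is `k[X]⧸(X^{min M N})`). [cite: AtiyahMacdonald1969, Ch. 8, Prop. 8.8 and Example] -/
theorem finrank_quotient_span_mk_X_pow (N M : ℕ) :
    Module.finrank k ((k[X] ⧸ Ideal.span {(X : k[X]) ^ N}) ⧸
      Ideal.span {(Ideal.Quotient.mk (Ideal.span {(X : k[X]) ^ N}) X) ^ M}) = min M N := by
  have hmap : Ideal.span {(Ideal.Quotient.mk (Ideal.span {(X : k[X]) ^ N}) X) ^ M} =
      (Ideal.span {(X : k[X]) ^ M}).map (Ideal.Quotient.mkₐ k (Ideal.span {(X : k[X]) ^ N})) := by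
    rw [Ideal.map_span, Set.image_singleton, Ideal.Quotient.mkₐ_eq_mk, map_pow]
  have hsup : Ideal.span {(X : k[X]) ^ N} ⊔ Ideal.span {(X : k[X]) ^ M} = Ideal.span {(X : k[X]) ^ min M N} := by
    rcases le_total M N with h | h
    · rw [min_eq_left h, sup_eq_right.mpr (Literature.RingTheory.PrincipalIdealRing.span_X_pow_le_span_X_pow h)]
    · rw [min_eq_right h, sup_eq_left.mpr (Literature.RingTheory.PrincipalIdealRing.span_X_pow_le_span_X_pow h)]
  rw [(Ideal.quotientEquivAlgOfEq k hmap).toLinearEquiv.finrank_eq,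
    (DoubleQuot.quotQuotEquivQuotSupₐ k (Ideal.span {(X : k[X]) ^ N}) (Ideal.span {(X : k[X]) ^ M})).toLinearEquiv.finrank_eq,
    (Ideal.quotientEquivAlgOfEq k hsup).toLinearEquiv.finrank_eq, finrank_quotient_span_eq_natDegree, natDegree_X_pow]

omit [ExpChar k p] [GrpObj G] in
/-- `dim_k Γ(G)⧸(x^M) = min M N` for `Γ(G) ≃ₐ[k] k[X]⧸(X^N)`, `x = ψ⁻¹ X̄` (transport of `finrank_quotient_span_mk_X_pow` along `ψ`).
[cite: AtiyahMacdonald1969, Ch. 8, Prop. 8.8 and Example] -/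
theorem finrank_quotient_span_symm_pow (ψ : AffineGroupScheme.Alg G ≃ₐ[k] (k[X] ⧸ Ideal.span {(X : k[X]) ^ N})) (M : ℕ) :
    Module.finrank k (AffineGroupScheme.Alg G ⧸ Ideal.span {ψ.symm (Ideal.Quotient.mk _ X) ^ M}) = min M N := by
  have hmap : Ideal.span {(Ideal.Quotient.mk (Ideal.span {(X : k[X]) ^ N}) X) ^ M} =
      (Ideal.span {ψ.symm (Ideal.Quotient.mk _ X) ^ M}).map (ψ : AffineGroupScheme.Alg G →+* _) := by
    rw [Ideal.map_span, Set.image_singleton, map_pow, RingHom.coe_coe, AlgEquiv.apply_symm_apply]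
  rw [(Ideal.quotientEquivAlg _ _ ψ hmap).toLinearEquiv.finrank_eq, finrank_quotient_span_mk_X_pow]

variable [IsFinite G.hom]

/-- The twist `G^{(p^t)} → Spec k` of a finite `k`-scheme is separated (base change of a finite, hence separated, morphism), so
`Ker F^t ↪ G` is a CLOSED IMMERSION (★ `isClosedImmersion_kerι_left_of_isSeparated`). [cite: GortzWedhorn2020, Definition 4.45 (2) (p. 117)] -/
theorem isClosedImmersion_kerι_relFrobeniusOver_left : IsClosedImmersion (kerι (relFrobeniusOver p t G)).left := by
  haveI : IsSeparated (frobeniusTwistOver p t G).hom := by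
    rw [frobeniusTwistOver_hom, twistSnd_def]
    infer_instance
  exact isClosedImmersion_kerι_left_of_isSeparated _

/-- `Ker F^t → Spec k` is finite (a closed subscheme of the finite `G`). [cite: GortzWedhorn2020, Definition 4.45 (2) (p. 117)] -/
theorem isFinite_ker_relFrobeniusOver_hom : IsFinite (ker (relFrobeniusOver p t G)).hom := by
  haveI := isClosedImmersion_kerι_relFrobeniusOver_left p t (G := G)
  have h : (kerι (relFrobeniusOver p t G)).left ≫ G.hom = (ker (relFrobeniusOver p t G)).hom := Over.w _
  rw [← h]
  infer_instance

/-- **RANK OF THE FROBENIUS KERNEL OF A MONOGENIC INFINITESIMAL GROUP: `dim_k Γ(Ker F^t_{G∕k}) = min(p^t, N)`** for `Γ(G) ≃ₐ[k] k[X]⧸(X^N)`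
(`N ≠ 0`): the kernel is `V(x^{p^t}) = Spec k[X]⧸(X^{min(p^t,N)})`. [cite: Demazure1972, Ch. II §7] [cite: SGA3I, VII_A 4.3]
[cite: Tate1967, §2.2] -/
theorem finrank_alg_ker_relFrobeniusOver (ψ : AffineGroupScheme.Alg G ≃ₐ[k] (k[X] ⧸ Ideal.span {(X : k[X]) ^ N})) (hN : N ≠ 0) :
    Module.finrank k (AffineGroupScheme.Alg (ker (relFrobeniusOver p t G))) = min (p ^ t) N := by
  haveI : IsAffine G.left := isAffine_of_isAffineHom G.hom
  haveI := isClosedImmersion_kerι_relFrobeniusOver_left p t (G := G)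
  rw [finrank_alg_eq_finrank_quotient_ker (kerι (relFrobeniusOver p t G)),
    (Ideal.quotientEquivAlgOfEq k (A := AffineGroupScheme.Alg G)
      (ker_appTop_kerι_relFrobeniusOver_eq_span p t (ker_appTop_unit_eq_span_of_algEquiv ψ hN))).toLinearEquiv.finrank_eq]
  exact finrank_quotient_span_symm_pow ψ (p ^ t)

omit [ExpChar k p] [GrpObj G] in
/-- A monogenic infinitesimal `k`-scheme has ONE POINT (`Γ(G)` is an Artin local ring, whose only prime is `𝔪`; `G ≅ Spec Γ(G)`).
[cite: Tate1967, §2.2] [cite: AtiyahMacdonald1969, Ch. 8, Prop. 8.8 and Example] -/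
theorem subsingleton_left_of_algEquiv (ψ : AffineGroupScheme.Alg G ≃ₐ[k] (k[X] ⧸ Ideal.span {(X : k[X]) ^ N})) (hN : N ≠ 0) :
    Subsingleton ↥G.left := by
  haveI : IsAffine G.left := isAffine_of_isAffineHom G.hom
  haveI := isLocalRing_of_algEquiv_quotient_X_pow ψ hN
  haveI := isArtinianRing_of_algEquiv_quotient_X_pow ψ hN
  have hPS : Subsingleton (PrimeSpectrum (AffineGroupScheme.Alg G)) := ⟨fun P Q => PrimeSpectrum.ext
    ((IsLocalRing.eq_maximalIdeal (IsArtinianRing.isMaximal_of_isPrime P.asIdeal)).trans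
      (IsLocalRing.eq_maximalIdeal (IsArtinianRing.isMaximal_of_isPrime Q.asIdeal)).symm)⟩
  have hS : Subsingleton ↥(Spec Γ(G.left, ⊤)) := hPS
  exact (Scheme.homeoOfIso G.left.isoSpec).toEquiv.subsingleton_congr.mpr hS

/-- `Ker F^t` has one point. [cite: SGA3I, VII_A 4.3] [cite: Tate1967, §2.2] -/
theorem subsingleton_ker_relFrobeniusOver_left (ψ : AffineGroupScheme.Alg G ≃ₐ[k] (k[X] ⧸ Ideal.span {(X : k[X]) ^ N}))
    (hN : N ≠ 0) : Subsingleton ↥(ker (relFrobeniusOver p t G)).left := by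
  haveI := isClosedImmersion_kerι_relFrobeniusOver_left p t (G := G)
  haveI := subsingleton_left_of_algEquiv (G := G) ψ hN
  exact (kerι (relFrobeniusOver p t G)).left.isClosedEmbedding.injective.subsingleton

-- Budget: the closed-immersion instance plumbing on `kerLift` elaborates near the default heartbeat ceiling; a 2× margin is declared.
set_option maxHeartbeats 400000 in
/-- **(FKw-a), rank form: a closed subscheme of `G` killed by `F^t` has rank `≤ min(p^t, N)`** — it factors through `Ker F^t` (★ `kerLift`,
a closed immersion), whose affine algebra therefore surjects onto it. [cite: SGA3I, VII_A 4.1–4.3] [cite: Demazure1972, Ch. II §7] -/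
theorem finrank_alg_le_of_comp_relFrobeniusOver_eq_one (ψ : AffineGroupScheme.Alg G ≃ₐ[k] (k[X] ⧸ Ideal.span {(X : k[X]) ^ N}))
    (hN : N ≠ 0) {Z : SchemeOver k} (c : Z ⟶ G) [IsClosedImmersion c.left] (hc : c ≫ relFrobeniusOver p t G = 1) :
    Module.finrank k (AffineGroupScheme.Alg Z) ≤ min (p ^ t) N := by
  haveI := isClosedImmersion_kerι_relFrobeniusOver_left p t (G := G)
  haveI := isFinite_ker_relFrobeniusOver_hom p t (G := G)
  haveI : IsAffine (ker (relFrobeniusOver p t G)).left := isAffine_of_isAffineHom (ker (relFrobeniusOver p t G)).hom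
  haveI : Module.Finite k (AffineGroupScheme.Alg (ker (relFrobeniusOver p t G))) := AffineGroupScheme.Alg.moduleFinite _
  have hcomp : IsClosedImmersion ((kerLift c hc).left ≫ (kerι (relFrobeniusOver p t G)).left) := by
    rw [← Over.comp_left, kerLift_ι]; infer_instance
  haveI : IsClosedImmersion (kerLift c hc).left := IsClosedImmersion.of_comp _ (kerι (relFrobeniusOver p t G)).left
  rw [← finrank_alg_ker_relFrobeniusOver p t ψ hN, finrank_alg_eq_finrank_quotient_ker (kerLift c hc)]
  exact Submodule.finrank_quotient_le
    ((RingHom.ker (kerLift c hc).left.appTop.hom : Ideal (AffineGroupScheme.Alg (ker (relFrobeniusOver p t G)))).restrictScalars k)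

/-! ### §2.5 Functoriality: the map `Ker F^t_G → Ker F^t_{G'}` induced by a homomorphism -/

omit [IsFinite G.hom] in
/-- For a homomorphism `φ : G → G'` of `k`-group schemes, `(ι ≫ φ) ≫ F^t_{G'} = 1` on `Ker F^t_G` (naturality `φ ≫ F^t_{G'} = F^t_G ≫ φ^{(p^t)}`,
★ `relFrobeniusOver_comp_map`, and ★ `kerι_comp_comp_eq_one_of_sq`) — the hypothesis of `kerLift` defining `Ker F^t_G → Ker F^t_{G'}`.
[cite: SGA3I, VII_A 4.1] [cite: GortzWedhorn2020, Definition 4.45 (2) (p. 117)] -/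
theorem kerι_relFrobeniusOver_comp_comp_eq_one {G' : SchemeOver k} [GrpObj G'] (φ : G ⟶ G') [IsMonHom φ] :
    (kerι (relFrobeniusOver p t G) ≫ φ) ≫ relFrobeniusOver p t G' = 1 :=
  kerι_comp_comp_eq_one_of_sq (relFrobeniusOver p t G) (relFrobeniusOver p t G') φ
    ((Over.pullback (frobSpec k p t)).map φ) (relFrobeniusOver_comp_map p t φ).symm

end Frobenius

/-! ## §3 The layers of a connected one-dimensional BT group -/

section BT

-- as in §2: statements of the shape `c ≫ F^t = 1` need the slow `One (T ⟶ G^{(p^t)})` instance search.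
set_option synthInstance.maxHeartbeats 200000

variable {k : Type u} [Field k] {p : ℕ} [ExpChar k p] {H : ℕ} (B : BTGroup (Spec (.of k)) p H) (t n : ℕ)

/-- **(FKw-b) RANK: `dim_k Γ(Ker F^t|_{𝒢ₙ}) = p^t` for `t ≤ nH`** on the layers `𝒢ₙ = B.G n` of a connected one-dimensional BT group
(`Γ(𝒢ₙ) ≃ k[X]⧸(X^{p^{nH}})`, so `Ker F^t = V(x^{p^t})`).  With `t = f`, `q = p^f`: the rank-`q` closed subgroup `C₀ = Ker F_q` of the
supersingular road. [cite: Tate1967, §2.2] [cite: Demazure1972, Ch. II §7] [cite: SGA3I, VII_A 4.3] -/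
theorem BTGroup.finrank_alg_frobKernel_of_isConnectedDimOne (hB : IsConnectedDimOne B) (ht : t ≤ n * H) :
    letI := B.grpObj n
    Module.finrank k (AffineGroupScheme.Alg (ker (relFrobeniusOver p t (B.G n)))) = p ^ t := by
  letI := B.grpObj n
  haveI := B.isFinite n
  have ψ : AffineGroupScheme.Alg (B.G n) ≃ₐ[k] (k[X] ⧸ Ideal.span {(X : k[X]) ^ (p ^ (n * H))}) := (hB n).some
  rw [Literature.AlgebraicGeometry.GroupSchemes.finrank_alg_ker_relFrobeniusOver p t ψ
    (B.pow_ne_zero_of_isConnectedDimOne hB n), min_eq_left]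
  exact Nat.pow_le_pow_right (expChar_pos k p) ht

/-- For `t ≥ nH` the whole layer is killed: `dim_k Γ(Ker F^t|_{𝒢ₙ}) = p^{nH} = dim_k Γ(𝒢ₙ)` (cf. ★ (FK) `InfinitesimalKilledByFrobeniusPower`).
[cite: Tate1967, §2.2] [cite: Demazure1972, Ch. II §7] -/
theorem BTGroup.finrank_alg_frobKernel_of_isConnectedDimOne_of_le (hB : IsConnectedDimOne B) (ht : n * H ≤ t) :
    letI := B.grpObj n
    Module.finrank k (AffineGroupScheme.Alg (ker (relFrobeniusOver p t (B.G n)))) = p ^ (n * H) := by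
  letI := B.grpObj n
  haveI := B.isFinite n
  have ψ : AffineGroupScheme.Alg (B.G n) ≃ₐ[k] (k[X] ⧸ Ideal.span {(X : k[X]) ^ (p ^ (n * H))}) := (hB n).some
  rw [Literature.AlgebraicGeometry.GroupSchemes.finrank_alg_ker_relFrobeniusOver p t ψ
    (B.pow_ne_zero_of_isConnectedDimOne hB n), min_eq_right]
  exact Nat.pow_le_pow_right (expChar_pos k p) ht

/-- The ideal of `Ker F^t|_{𝒢ₙ} ↪ 𝒢ₙ` is `𝔪^{p^t}` — «`Ker F^t = V(x^{p^t})` for ANY generator `x` of the maximal ideal of `Γ(𝒢ₙ)`».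
[cite: Tate1967, §2.2] [cite: Demazure1972, Ch. II §7] [cite: AtiyahMacdonald1969, Ch. 8, Prop. 8.8 and Example] -/
theorem BTGroup.ker_appTop_frobKernelι_eq_maximalIdeal_pow (hB : IsConnectedDimOne B)
    [IsLocalRing (AffineGroupScheme.Alg (B.G n))] :
    letI := B.grpObj n
    RingHom.ker (kerι (relFrobeniusOver p t (B.G n))).left.appTop.hom = maximalIdeal (AffineGroupScheme.Alg (B.G n)) ^ p ^ t := by
  letI := B.grpObj n
  haveI := B.isAffine_left n
  have ψ : AffineGroupScheme.Alg (B.G n) ≃ₐ[k] (k[X] ⧸ Ideal.span {(X : k[X]) ^ (p ^ (n * H))}) := (hB n).some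
  refine (Literature.AlgebraicGeometry.GroupSchemes.ker_appTop_kerι_relFrobeniusOver_eq_span p t
    (ker_appTop_unit_eq_span_of_algEquiv ψ (B.pow_ne_zero_of_isConnectedDimOne hB n))).trans ?_
  rw [maximalIdeal_eq_span_of_algEquiv_quotient_X_pow ψ, Ideal.span_singleton_pow]
  rfl

/-- `Ker F^t|_{𝒢ₙ}` has ONE POINT. [cite: SGA3I, VII_A 4.3] [cite: Tate1967, §2.2] -/
theorem BTGroup.subsingleton_frobKernel_left (hB : IsConnectedDimOne B) :
    letI := B.grpObj n
    Subsingleton ↥(ker (relFrobeniusOver p t (B.G n))).left := by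
  letI := B.grpObj n
  haveI := B.isFinite n
  have ψ : AffineGroupScheme.Alg (B.G n) ≃ₐ[k] (k[X] ⧸ Ideal.span {(X : k[X]) ^ (p ^ (n * H))}) := (hB n).some
  exact Literature.AlgebraicGeometry.GroupSchemes.subsingleton_ker_relFrobeniusOver_left p t ψ
    (B.pow_ne_zero_of_isConnectedDimOne hB n)

/-- **(FKw-a): a closed subscheme of `𝒢ₙ` killed by `F^t` has rank `≤ p^t`** (`t ≤ nH`) — it lies in `Ker F^t = V(x^{p^t})`.
[cite: SGA3I, VII_A 4.1–4.3] [cite: Demazure1972, Ch. II §7] -/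
theorem BTGroup.finrank_alg_le_of_comp_relFrobeniusOver_eq_one (hB : IsConnectedDimOne B) (ht : t ≤ n * H) {Z : SchemeOver k}
    (c : Z ⟶ B.G n) [IsClosedImmersion c.left] (hc : letI := B.grpObj n; c ≫ relFrobeniusOver p t (B.G n) = 1) :
    Module.finrank k (AffineGroupScheme.Alg Z) ≤ p ^ t := by
  letI := B.grpObj n
  haveI := B.isFinite n
  have ψ : AffineGroupScheme.Alg (B.G n) ≃ₐ[k] (k[X] ⧸ Ideal.span {(X : k[X]) ^ (p ^ (n * H))}) := (hB n).some
  refine (Literature.AlgebraicGeometry.GroupSchemes.finrank_alg_le_of_comp_relFrobeniusOver_eq_one p t ψ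
    (B.pow_ne_zero_of_isConnectedDimOne hB n) c hc).trans ?_
  rw [min_eq_left (Nat.pow_le_pow_right (expChar_pos k p) ht)]

omit [ExpChar k p] in
/-- **CLOSED SUBSCHEMES OF `𝒢ₙ` ARE NESTED BY RANK** (§1 for the layers of a connected one-dimensional BT group): `dim_k Γ(Z₁) ≤ dim_k Γ(Z₂)`
⇒ `Z₁ ⊆ Z₂`. [cite: Tate1967, §2.2] [cite: AtiyahMacdonald1969, Ch. 8, Prop. 8.8 and Example] -/
theorem BTGroup.exists_fac_of_finrank_alg_le (hB : IsConnectedDimOne B) {Z₁ Z₂ : SchemeOver k} (c₁ : Z₁ ⟶ B.G n) (c₂ : Z₂ ⟶ B.G n)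
    [IsClosedImmersion c₁.left] [IsClosedImmersion c₂.left]
    (h : Module.finrank k (AffineGroupScheme.Alg Z₁) ≤ Module.finrank k (AffineGroupScheme.Alg Z₂)) :
    ∃ f : Z₁ ⟶ Z₂, f ≫ c₂ = c₁ := by
  haveI := B.isFinite n
  have ψ : AffineGroupScheme.Alg (B.G n) ≃ₐ[k] (k[X] ⧸ Ideal.span {(X : k[X]) ^ (p ^ (n * H))}) := (hB n).some
  haveI := isLocalRing_of_algEquiv_quotient_X_pow ψ (B.pow_ne_zero_of_isConnectedDimOne hB n)
  exact Literature.AlgebraicGeometry.GroupSchemes.exists_fac_of_finrank_alg_le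
    ⟨⟨_, maximalIdeal_eq_span_of_algEquiv_quotient_X_pow ψ⟩⟩ c₁ c₂ h

omit [ExpChar k p] in
/-- **ONE CLOSED SUBSCHEME OF `𝒢ₙ` OF EACH RANK**: a `𝒢ₙ`-morphism between closed subschemes of equal rank is an isomorphism (so, on the
`μ`-ordinary road, `𝒢⁰ₙ[ϖ] = Ker F_q` as soon as both have rank `q`). [cite: Tate1967, §2.2] [cite: AtiyahMacdonald1969, Ch. 8, Prop. 8.8 and Example] -/
theorem BTGroup.isIso_of_finrank_alg_eq (hB : IsConnectedDimOne B) {Z₁ Z₂ : SchemeOver k} (c₁ : Z₁ ⟶ B.G n) (c₂ : Z₂ ⟶ B.G n)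
    [IsClosedImmersion c₁.left] [IsClosedImmersion c₂.left] (f : Z₁ ⟶ Z₂) (hf : f ≫ c₂ = c₁)
    (h : Module.finrank k (AffineGroupScheme.Alg Z₁) = Module.finrank k (AffineGroupScheme.Alg Z₂)) : IsIso f := by
  haveI := B.isFinite n
  have ψ : AffineGroupScheme.Alg (B.G n) ≃ₐ[k] (k[X] ⧸ Ideal.span {(X : k[X]) ^ (p ^ (n * H))}) := (hB n).some
  haveI := isLocalRing_of_algEquiv_quotient_X_pow ψ (B.pow_ne_zero_of_isConnectedDimOne hB n)
  exact Literature.AlgebraicGeometry.GroupSchemes.isIso_of_finrank_alg_eq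
    ⟨⟨_, maximalIdeal_eq_span_of_algEquiv_quotient_X_pow ψ⟩⟩ c₁ c₂ f hf h

/-- **(FKw-b) «INDEPENDENT OF `n`»: the homomorphism `Ker F^t|_{𝒢ₙ} → Ker F^t|_{𝒢ₙ₊₁}` induced by the transition `incl n` is an
ISOMORPHISM for `t ≤ nH`** — both are closed subschemes of `𝒢ₙ₊₁` of rank `p^t` (`BTGroup.isIso_of_finrank_alg_eq`).
[cite: Tate1967, §2.2 and (2.1)] [cite: Demazure1972, Ch. II §7] -/
theorem BTGroup.isIso_kerLift_frobKernel_incl (hB : IsConnectedDimOne B) (ht : t ≤ n * H) :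
    letI := B.grpObj n; letI := B.grpObj (n + 1); haveI := B.incl_isMonHom n
    IsIso (kerLift (f := relFrobeniusOver p t (B.G (n + 1))) (kerι (relFrobeniusOver p t (B.G n)) ≫ B.incl n)
      (kerι_relFrobeniusOver_comp_comp_eq_one p t (B.incl n))) := by
  letI := B.grpObj n; letI := B.grpObj (n + 1); haveI := B.incl_isMonHom n
  haveI := B.isFinite n
  haveI := B.isFinite (n + 1)
  haveI := B.isClosedImmersion_incl n
  haveI := isClosedImmersion_kerι_relFrobeniusOver_left p t (G := B.G n)
  haveI := isClosedImmersion_kerι_relFrobeniusOver_left p t (G := B.G (n + 1))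
  haveI : IsClosedImmersion (kerι (relFrobeniusOver p t (B.G n)) ≫ B.incl n).left := by
    rw [Over.comp_left]; infer_instance
  have h1 := B.finrank_alg_frobKernel_of_isConnectedDimOne t n hB ht
  have h2 := B.finrank_alg_frobKernel_of_isConnectedDimOne t (n + 1) hB (ht.trans (Nat.mul_le_mul_right H (Nat.le_succ n)))
  exact B.isIso_of_finrank_alg_eq (n + 1) hB (kerι (relFrobeniusOver p t (B.G n)) ≫ B.incl n)
    (kerι (relFrobeniusOver p t (B.G (n + 1)))) _ (kerLift_ι _ _) (h1.trans h2.symm)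

end BT

/-! ## §4 (ED. 2) The Frobenius-kernel IDEAL as a carrier: functoriality ∕ stability under endomorphisms, colength
(the `AdmSub` currency of P6c's CONSTRUCTOR-SKELETON v0 §1: `kerF x̄ := ker Γ(ι_{Ker F^f})`, «rank `q` and `β`-stable») -/

section IdealCurrency

-- as in §2: statements of the shape `c ≫ F^t = 1` need the slow `One (T ⟶ G^{(p^t)})` instance search.
set_option synthInstance.maxHeartbeats 200000

variable {k : Type u} [Field k] (p : ℕ) [ExpChar k p] (t : ℕ) {G G' : SchemeOver k} [GrpObj G] [GrpObj G']

/-- **The Frobenius-kernel ideal is FUNCTORIAL ∕ STABLE**: for a homomorphism `φ : G → G'` of `k`-group schemes, `Γ(φ)` maps the ideal of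
`Ker F^t_{G'} ↪ G'` into the ideal of `Ker F^t_G ↪ G` — `φ` restricts to `Ker F^t_G → Ker F^t_{G'}` (★ `kerLift` over
`kerι_relFrobeniusOver_comp_comp_eq_one`).  With `G' = G` and `φ = β(a)` an endomorphism (an `𝒪`-action): the ideal `kerF` is `β`-STABLE,
`Ideal.map Γ(β a) kerF ≤ kerF`. [cite: SGA3I, VII_A 4.1] [cite: GortzWedhorn2020, Definition 4.45 (2) (p. 117)] -/
theorem map_ker_appTop_kerι_relFrobeniusOver_le (φ : G ⟶ G') [IsMonHom φ] :
    Ideal.map φ.left.appTop.hom (RingHom.ker (kerι (relFrobeniusOver p t G')).left.appTop.hom) ≤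
      RingHom.ker (kerι (relFrobeniusOver p t G)).left.appTop.hom := by
  rw [Ideal.map_le_iff_le_comap]
  intro s hs
  rw [Ideal.mem_comap, RingHom.mem_ker]
  have hfac := kerLift_ι (kerι (relFrobeniusOver p t G) ≫ φ) (kerι_relFrobeniusOver_comp_comp_eq_one p t φ)
  have h : (kerLift (kerι (relFrobeniusOver p t G) ≫ φ) (kerι_relFrobeniusOver_comp_comp_eq_one p t φ) ≫
        kerι (relFrobeniusOver p t G')).left.appTop.hom s = (kerι (relFrobeniusOver p t G) ≫ φ).left.appTop.hom s := by
    rw [hfac]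
  rw [Over.comp_left, Over.comp_left, Scheme.Hom.comp_appTop, Scheme.Hom.comp_appTop] at h
  change (kerLift (kerι (relFrobeniusOver p t G) ≫ φ) (kerι_relFrobeniusOver_comp_comp_eq_one p t φ)).left.appTop.hom
      ((kerι (relFrobeniusOver p t G')).left.appTop.hom s) =
    (kerι (relFrobeniusOver p t G)).left.appTop.hom (φ.left.appTop.hom s) at h
  rw [← h, RingHom.mem_ker.mp hs, map_zero]

/-- `comap` form of the same functoriality: `ker Γ(ι_{Ker F^t_{G'}}) ≤ Γ(φ)⁻¹ (ker Γ(ι_{Ker F^t_G}))`.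
[cite: SGA3I, VII_A 4.1] [cite: GortzWedhorn2020, Definition 4.45 (2) (p. 117)] -/
theorem ker_appTop_kerι_relFrobeniusOver_le_comap (φ : G ⟶ G') [IsMonHom φ] :
    RingHom.ker (kerι (relFrobeniusOver p t G')).left.appTop.hom ≤
      Ideal.comap φ.left.appTop.hom (RingHom.ker (kerι (relFrobeniusOver p t G)).left.appTop.hom) :=
  Ideal.map_le_iff_le_comap.mp (map_ker_appTop_kerι_relFrobeniusOver_le p t φ)

variable {N : ℕ}

/-- **COLENGTH of the Frobenius-kernel ideal: `dim_k Γ(G)⧸ker Γ(ι_{Ker F^t}) = min(p^t, N)`** for `Γ(G) ≃ₐ[k] k[X]⧸(X^N)`, `N ≠ 0` — the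
`Module.finrank κ (Alg G ⧸ I) = q` clause of an admissible ideal, for `I = kerF` (`t = f`, `q = p^f ≤ N`). [cite: Demazure1972, Ch. II §7]
[cite: AtiyahMacdonald1969, Ch. 8, Prop. 8.8 and Example] -/
theorem finrank_quotient_ker_appTop_kerι_relFrobeniusOver [IsFinite G.hom]
    (ψ : AffineGroupScheme.Alg G ≃ₐ[k] (k[X] ⧸ Ideal.span {(X : k[X]) ^ N})) (hN : N ≠ 0) :
    Module.finrank k (AffineGroupScheme.Alg G ⧸ RingHom.ker (kerι (relFrobeniusOver p t G)).left.appTop.hom) = min (p ^ t) N := by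
  haveI : IsAffine G.left := isAffine_of_isAffineHom G.hom
  haveI := isClosedImmersion_kerι_relFrobeniusOver_left p t (G := G)
  rw [← finrank_alg_eq_finrank_quotient_ker (kerι (relFrobeniusOver p t G))]
  exact finrank_alg_ker_relFrobeniusOver p t ψ hN

/-- The ideal of `Ker F^t ↪ G` is `𝔪^{p^t}` for `Γ(G) ≃ₐ[k] k[X]⧸(X^N)` (`N ≠ 0`; any such `G`, not only BT layers: e.g. the `[ϖ]`-kernel of a
connected one-dimensional BT group with `𝒪`-action, `N = q²`). [cite: Demazure1972, Ch. II §7] [cite: AtiyahMacdonald1969, Ch. 8, Prop. 8.8 and Example] -/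
theorem ker_appTop_kerι_relFrobeniusOver_eq_maximalIdeal_pow [IsFinite G.hom] [IsLocalRing (AffineGroupScheme.Alg G)]
    (ψ : AffineGroupScheme.Alg G ≃ₐ[k] (k[X] ⧸ Ideal.span {(X : k[X]) ^ N})) (hN : N ≠ 0) :
    RingHom.ker (kerι (relFrobeniusOver p t G)).left.appTop.hom = maximalIdeal (AffineGroupScheme.Alg G) ^ p ^ t := by
  haveI : IsAffine G.left := isAffine_of_isAffineHom G.hom
  refine (ker_appTop_kerι_relFrobeniusOver_eq_span p t (ker_appTop_unit_eq_span_of_algEquiv ψ hN)).trans ?_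
  rw [maximalIdeal_eq_span_of_algEquiv_quotient_X_pow ψ, Ideal.span_singleton_pow]
  rfl

end IdealCurrency

end Literature.AlgebraicGeometry.GroupSchemes

end
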